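import Mathlib
import HarnessLib

/-!
# Symmetry-row inertness (critic-1 obstruction sheet O13): finite-group convex averaging
# (hubbard-cq cell; OBSTRUCTIONS-critic-1 v1.15 / v1.16 §O13; PRE-REGISTRATION 10 = pilot-1 job W, kit j277187, "SU(2) Ward rows")

HONEST FRAMING: certificate-GRAMMAR bookkeeping about what adding symmetry ("Ward") rows to a moment/SOS
relaxation can and cannot do; nothing here is a number of the Hubbard model, an order parameter or a phase word.
Pure convex / linear algebra over `Mathlib`; no Hubbard-specific declaration is used; zero compute; two auxiliary
`def`s (`grpAvg`, `fixedSet`); no named fact; no `sorry`.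

PROVENANCE / LANE: obstruction-sheet entry **O13 SYMMETRY-ROW INERTNESS** of `HOME/critic/OBSTRUCTIONS-critic-1.md`
(addenda v1.15 2026-08-27T11:33Z and v1.16 11:41Z; the SU(2)-Ward member of the O10 KKT-blindness / O12 void-row
family), typed core by hubbard-cq-critic-1 g7 (`HOME/lean/SymmetryRowInertness.critic1.lean`, sha16 105112ae0f29f3a6,
186 lines, farm rc 0); landed by hubbard-cq-p1 g14 on the cell lead's ★ RULING 244 (4) — critic-1's bytes, p1's
proposal; the only edits are this paragraph, the SCOPE / EMPIRICAL TEST paragraph below and two added docstrings.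
Same lane and shape as `Observables/KKTBlindnessSliceNesting.lean` (critic-1 section → cell file).

SCOPE (= the hypotheses `hmaps` / `hc` read for an engine object): relaxations whose constraint families are CLOSED
under the symmetry group — for the spin-SU(2) reading of bridge (B1): block families that are SPIN-COMPLETE (every
spin label of each spatial template enumerated; truncation by degree / box / bond only; stars singlets; blocks split
by `S_z` charge only), symmetry-reduction identifications by a subgroup handled as in bridge (B3), and an invariant
(singlet) objective. Outside that scope (spin-incomplete truncations, `S_z`-polarised or triplet data, unequal
filling rows) the theorems below say nothing and symmetry rows CAN move a value — that is O13's «where Ward rows bite».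
EMPIRICAL TEST (live, OUTCOME PENDING at typing): pilot-1 job W = kit **j277187** «SU(2)-Ward-row lever» on the gbT
union object; critic-1's pre-registered call (PREREG-SCORING.md §10) = INERT, lift = 0 exactly up to solver noise
(≲ 5·10⁻⁴ at SCS eps 1e-4). A reproducible lift ≥ 0.002 (or E5w certified > −1.2250) would refute bridge (B1)/(B3)
FOR THE OBJECT AS BUILT (a spin-incompleteness or a non-normalising reduction subgroup) — a finding about the engine,
not about the theorems of this file, which are unconditional statements of convex algebra. critic-2's concur /
dissent on the mechanism call rides on the cell bus, not on this landing.

**Abstract setting.** `V` = the vector space of moment vectors of a relaxation, `C ⊆ V` its feasible set (convex),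
a finite group `G` acting linearly on `V` through `ρ : G →* (V →ₗ[ℝ] V)` such that every `ρ g` maps `C` into `C`
(each constraint family — PSD blocks, star/EOM rows, translation/point-group identifications, filling and window
rows — is closed under the action), and a `G`-invariant linear objective `c` (`c ∘ ρ g = c`).

**Theorems.**
* `grpAvg_mem`       : the group average `ȳ = |G|⁻¹ ∑_g ρ g y` of a feasible point is feasible (`Convex.sum_mem`);
* `objective_grpAvg` : `c ȳ = c y`;
* `grpAvg_fixed`     : `ρ h ȳ = ȳ` for every `h` (reindex the sum by `Equiv.mulLeft h`) — the average satisfies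
                       every "finite Ward row" `ℓ (ρ h x - x) = 0` (`wardRow_eq_zero_of_mem_fixedSet`);
* `image_inter_fixed_eq` / `image_inter_eq_of_fixed_subset` : the SET OF OBJECTIVE VALUES over `C` equals the set
  of objective values over `C ∩ Fix(G)`, and over `C ∩ K` for ANY constraint set `K` implied by `G`-fixedness on `C`
  (`C ∩ Fix(G) ⊆ K`);
* `sInf_image_inter_eq_of_fixed_subset`, `lowerBound_iff_of_fixed_subset` : hence neither the infimum nor the set
  of valid lower bounds moves when such rows `K` are added — symmetry rows cut the feasible SET, never the
  certified VALUE.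

**Bridge to the job-W object (on paper; two steps, labelled).**
(B1) [engine reading: `obsb`'s `words_deg_le` / `bond_words` enumerate all spin labels, stars are singlets, blocks
are `S_z`-graded] the gbT relaxation's constraint families are closed under spin rotations, and `H`, the singlet
pair source, the filling pair and the window rows are spin singlets ⇒ `hmaps`, `hc` hold for the restriction of the
SU(2) action to any finite subgroup `G ⊂ SU(2)`.
(B2) [exact character count, integer-valued; Klein 1884: `ℂ[x,y]^{2I}` is generated in degrees 12, 20, 30] the
binary icosahedral group `2I ⊂ SU(2)` (order 120; classes by SU(2) half-angle α: 1×0, 1×π, 30×π/2, 20×π/3, 20×2π/3,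
12×π/5, 12×2π/5, 12×3π/5, 12×4π/5) has invariant multiplicity `(1/120) ∑ |cl| sin((2j+1)α)/sin α` in the spin-`j`
irrep `V_j = Sym^{2j} ℂ²` equal to 1,0,0,0,0,0,0,0,0,0,0,0,1 for 2j = 0,…,12 (script
HOME/hubbard-cq-critic-1/calc/binary_polyhedral_invariants.py): NO fixed vector for 1 ≤ 2j ≤ 11. Block entries of the
L5 object are words of ≤ 8 fermion letters, each letter a spin-½ doublet, so they span spins `j ≤ 4` ⇒ a `2I`-fixed
moment vector is SU(2)-fixed on every block entry ⇒ it satisfies the infinitesimal Ward rows `ω([S^a, X]) = 0` for all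
`X` with `[S^a, X]` supported on ≤ 8 letters. (The binary OCTAHEDRAL group, order 48, is NOT enough at L5: multiplicities
1,0,0,0,0,0,0,0,1 for 2j = 0..8 — the degree-8 Klein form `x⁸ + 14x⁴y⁴ + y⁸` is a fixed vector in `V_4`; the binary
tetrahedral group already fails at 2j = 6.) With `G = 2I` and `K = {Ward rows}`, `lowerBound_iff_of_fixed_subset` gives
lift = 0 exactly; observed lifts are solver noise (≲ 5·10⁻⁴ at SCS eps 1e-4). Falsifier: a reproducible lift ≥ 0.002 in
job W refutes (B1) for the object AS BUILT (block pruning / `s37` / `symred` not spin-complete) — not this file.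

(B3) [symmetry reduction as built] the engine does not optimise over the raw feasible set `C₀` but over
`C₀ ∩ Fix(S)`, `S` = ⟨translations, twisted D₄, flip⟩ (`symred` identifications). A single spin rotation need NOT
preserve `Fix(S)` (flip only normalises SU(2)), so the lemma is applied to `C = C₀` with the FINITE group
`G = ⟨S, 2I⟩` — finite because flip's spin part is an order-4 element of SU(2) and `2I` can be conjugated to contain it
(all order-4 elements of SU(2) are conjugate; `2I` has 30), so `G ≤ (lattice group) × N(2I)·(gauge phases)` is finite —
and with `K₂ = Fix(S)`, `K₁ = Fix(S) ∩ {Ward rows}`, both ⊇ `C₀ ∩ Fix(G)`: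
`image_inter_eq_image_inter_of_fixed_subset` gives `c″(C₀ ∩ Fix S ∩ Ward) = c″(C₀ ∩ Fix S)` — the reduced problem's
values with and without Ward rows coincide. (If `symred` were replaced by a reduction under a subgroup NOT normalised
this way, inertness could fail for the reduced problem while holding for `C₀` — a diagnostic, should job W show a lift.)

References: critic-1 OBSTRUCTIONS v1.16 (cell file); F. Klein, *Vorlesungen über das Ikosaeder* (1884), Part I Ch. II
§§11–13 (invariant forms of the binary polyhedral groups); any convexity text for `Convex.sum_mem`.
-/

namespace Summit.Ventures.CertifiedManyBodySolver.Observables.SymmetryRowInertness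

open Finset
open scoped BigOperators

variable {G V : Type*} [Group G] [Fintype G] [AddCommGroup V] [Module ℝ V]

/-- The group average of `y` under the linear action `ρ`. -/
noncomputable def grpAvg (ρ : G →* (V →ₗ[ℝ] V)) (y : V) : V :=
  ∑ g : G, (Fintype.card G : ℝ)⁻¹ • ρ g y

/-- The fixed-point set of the action. -/
def fixedSet (ρ : G →* (V →ₗ[ℝ] V)) : Set V := {x | ∀ g : G, ρ g x = x}

omit [Group G] in
/-- The uniform weights `|G|⁻¹` over a nonempty finite type sum to `1`. -/
private lemma sum_weights_eq_one [Nonempty G] :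
    ∑ _g : G, (Fintype.card G : ℝ)⁻¹ = 1 := by
  rw [Finset.sum_const, Finset.card_univ, nsmul_eq_mul]
  have h : (Fintype.card G : ℝ) ≠ 0 := Nat.cast_ne_zero.mpr Fintype.card_ne_zero
  exact mul_inv_cancel₀ h

/-- A convex feasible set closed under the action contains the group average of each of its points. -/
theorem grpAvg_mem (ρ : G →* (V →ₗ[ℝ] V)) {C : Set V} (hC : Convex ℝ C)
    (hmaps : ∀ g : G, Set.MapsTo (ρ g) C C) {y : V} (hy : y ∈ C) :
    grpAvg ρ y ∈ C := by
  unfold grpAvg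
  refine hC.sum_mem (fun g _ => by positivity) sum_weights_eq_one (fun g _ => hmaps g hy)

/-- An invariant linear objective takes the same value at `y` and at its group average. -/
theorem objective_grpAvg (ρ : G →* (V →ₗ[ℝ] V)) (c : V →ₗ[ℝ] ℝ)
    (hc : ∀ g : G, c ∘ₗ ρ g = c) (y : V) :
    c (grpAvg ρ y) = c y := by
  unfold grpAvg
  rw [map_sum]
  have hterm : ∀ g : G, c ((Fintype.card G : ℝ)⁻¹ • ρ g y) = (Fintype.card G : ℝ)⁻¹ * c y := by
    intro g
    rw [map_smul, smul_eq_mul]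
    have := LinearMap.congr_fun (hc g) y
    rw [LinearMap.comp_apply] at this
    rw [this]
  simp_rw [hterm]
  rw [← Finset.sum_mul, sum_weights_eq_one, one_mul]

/-- The group average is fixed by every group element ("finite Ward rows" hold at the average). -/
theorem grpAvg_fixed (ρ : G →* (V →ₗ[ℝ] V)) (y : V) (h : G) :
    ρ h (grpAvg ρ y) = grpAvg ρ y := by
  unfold grpAvg
  rw [map_sum]
  simp_rw [map_smul, ← Module.End.mul_apply, ← map_mul]
  -- reindex the sum by left multiplication with `h`
  exact Fintype.sum_equiv (Equiv.mulLeft h)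
    (fun g => (Fintype.card G : ℝ)⁻¹ • ρ (h * g) y)
    (fun g => (Fintype.card G : ℝ)⁻¹ • ρ g y) (fun g => rfl)

/-- The group average lies in the fixed-point set of the action. -/
theorem grpAvg_mem_fixedSet (ρ : G →* (V →ₗ[ℝ] V)) (y : V) : grpAvg ρ y ∈ fixedSet ρ :=
  fun h => grpAvg_fixed ρ y h

omit [Fintype G] in
/-- Every "finite Ward row" `ℓ (ρ h x - x)` vanishes on the fixed set. -/
theorem wardRow_eq_zero_of_mem_fixedSet (ρ : G →* (V →ₗ[ℝ] V)) (ℓ : V →ₗ[ℝ] ℝ) (h : G)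
    {x : V} (hx : x ∈ fixedSet ρ) : ℓ (ρ h x - x) = 0 := by
  rw [hx h, sub_self, map_zero]

/-- **Symmetry-row inertness, set form.** The objective values over the feasible set coincide with
the objective values over the `G`-fixed feasible points. -/
theorem image_inter_fixed_eq (ρ : G →* (V →ₗ[ℝ] V)) {C : Set V} (hC : Convex ℝ C)
    (hmaps : ∀ g : G, Set.MapsTo (ρ g) C C) (c : V →ₗ[ℝ] ℝ) (hc : ∀ g : G, c ∘ₗ ρ g = c) :
    c '' (C ∩ fixedSet ρ) = c '' C := by
  apply Set.Subset.antisymm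
  · exact Set.image_mono Set.inter_subset_left
  · rintro _ ⟨y, hy, rfl⟩
    exact ⟨grpAvg ρ y, ⟨grpAvg_mem ρ hC hmaps hy, grpAvg_mem_fixedSet ρ y⟩,
      objective_grpAvg ρ c hc y⟩

/-- **Symmetry-row inertness, row form.** Adding ANY constraint set `K` that is implied by
`G`-fixedness on `C` (e.g. the rows `ℓ (ρ h x - x) = 0`, or their infinitesimal SU(2) versions via
bridge (B2)) leaves the set of objective values unchanged. -/
theorem image_inter_eq_of_fixed_subset (ρ : G →* (V →ₗ[ℝ] V)) {C K : Set V} (hC : Convex ℝ C)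
    (hmaps : ∀ g : G, Set.MapsTo (ρ g) C C) (c : V →ₗ[ℝ] ℝ) (hc : ∀ g : G, c ∘ₗ ρ g = c)
    (hK : C ∩ fixedSet ρ ⊆ K) :
    c '' (C ∩ K) = c '' C := by
  apply Set.Subset.antisymm
  · exact Set.image_mono Set.inter_subset_left
  · rw [← image_inter_fixed_eq ρ hC hmaps c hc]
    exact Set.image_mono fun x hx => ⟨hx.1, hK hx⟩

/-- **Symmetry-row inertness, bound form.** The optimal (infimal) certified value does not move. -/
theorem sInf_image_inter_eq_of_fixed_subset (ρ : G →* (V →ₗ[ℝ] V)) {C K : Set V}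
    (hC : Convex ℝ C) (hmaps : ∀ g : G, Set.MapsTo (ρ g) C C) (c : V →ₗ[ℝ] ℝ)
    (hc : ∀ g : G, c ∘ₗ ρ g = c) (hK : C ∩ fixedSet ρ ⊆ K) :
    sInf (c '' (C ∩ K)) = sInf (c '' C) := by
  rw [image_inter_eq_of_fixed_subset ρ hC hmaps c hc hK]

/-- The same for any lower bound: `b` is a valid lower bound of the objective on `C ∩ K`
iff it is one on `C` — a certificate "with Ward rows" certifies nothing a certificate without them
does not. -/
theorem lowerBound_iff_of_fixed_subset (ρ : G →* (V →ₗ[ℝ] V)) {C K : Set V}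
    (hC : Convex ℝ C) (hmaps : ∀ g : G, Set.MapsTo (ρ g) C C) (c : V →ₗ[ℝ] ℝ)
    (hc : ∀ g : G, c ∘ₗ ρ g = c) (hK : C ∩ fixedSet ρ ⊆ K) (b : ℝ) :
    (∀ x ∈ C ∩ K, b ≤ c x) ↔ (∀ x ∈ C, b ≤ c x) := by
  constructor
  · intro hb x hx
    have : c x ∈ c '' (C ∩ K) := by
      rw [image_inter_eq_of_fixed_subset ρ hC hmaps c hc hK]; exact ⟨x, hx, rfl⟩
    obtain ⟨x', hx', hcx⟩ := this
    rw [← hcx]; exact hb x' hx'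
  · intro hb x hx; exact hb x hx.1

/-- **Two row-sets implied by fixedness give the same values.** Used with `C` = the UN-reduced feasible set,
`K₂` = the symmetry-reduction identifications actually imposed by the engine (`symred`: fixedness under the
lattice/flip subgroup `S ≤ G`) and `K₁ = K₂ ∩ {Ward rows}`: the symmetry-reduced problem with and without Ward
rows has the same set of objective values (bridge (B3)). -/
theorem image_inter_eq_image_inter_of_fixed_subset (ρ : G →* (V →ₗ[ℝ] V)) {C K₁ K₂ : Set V}
    (hC : Convex ℝ C) (hmaps : ∀ g : G, Set.MapsTo (ρ g) C C) (c : V →ₗ[ℝ] ℝ)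
    (hc : ∀ g : G, c ∘ₗ ρ g = c) (hK₁ : C ∩ fixedSet ρ ⊆ K₁) (hK₂ : C ∩ fixedSet ρ ⊆ K₂) :
    c '' (C ∩ K₁) = c '' (C ∩ K₂) := by
  rw [image_inter_eq_of_fixed_subset ρ hC hmaps c hc hK₁, image_inter_eq_of_fixed_subset ρ hC hmaps c hc hK₂]

omit [Fintype G] in
/-- Fixed points of the whole group are fixed points of any subfamily (e.g. the engine's reduction subgroup). -/
theorem fixedSet_subset_of_comp (ρ : G →* (V →ₗ[ℝ] V)) {S : Type*} (ι : S → G) :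
    fixedSet ρ ⊆ {x | ∀ s : S, ρ (ι s) x = x} :=
  fun _ hx s => hx (ι s)

end Summit.Ventures.CertifiedManyBodySolver.Observables.SymmetryRowInertness
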